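import Summits.BirchSwinnertonDyer.BirchSwinnertonDyer.Theorems.EisensteinPrimesFullDescentKummerArithmetic
import Literature.NumberTheory.EllipticCurves.MasserWustholzTwistBoundProofs
import Literature.NumberTheory.EllipticCurves.Rank1Residual.GVParityTwistProofs
import Literature.NumberTheory.EllipticCurves.CyclotomicZpExtensionLayerOneSqrtTwoProofs
import Literature.NumberTheory.EllipticCurves.CyclotomicZpExtensionUnramifiedAwayPProofs
import HarnessLib

/-!
# Route `TwoAdicConverse` (rung S3), crux `OrdLambdaHalfAtTwo` (item stmt-BirchSwinnertonDyer-19556), line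
# `kato-determinant-greenberg-two`, stub `stub_wbarStepAtTwo` ([C], the `w̄`-step) — brick R0:
# **the only quadratic extension of `ℚ` unramified at every odd prime and at `∞` is `ℚ(√2) = ℚ_1`**

Cell `bsd-2adic`, seat `bsd-2adic-conv-1` GEN 26 (`--supports` stmt-BirchSwinnertonDyer-19556, helper; pen RC-325:
cor–Ver road of cruxtriage-19556-r1-1 GEN 11 Δ1, sub-lemma (h2), base of the layer induction).  In Galois form: an OPEN
subgroup `U ≤ Γ_ℚ` of index `2` containing the inertia group `I_𝔓` of EVERY prime `𝔓` of `\bar ℤ` above EVERY odd prime and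
EVERY complex conjugation is `Gal(ℚ̄/ℚ_1)`, the first layer of the cyclotomic `ℤ₂`-extension (`ℚ_1 = ℚ(√2)`).

Proof (Kummer, no class field theory): `U = Stab(√d)` for some `d ∈ ℚˣ` (tree
`MasserWustholz1993.exists_eq_stabilizer_geomSqrt_of_index_eq_two`); an inertia group above an odd `p` fixing `√d` forces
`2 ∣ ord_p(d)` (§2, the square analogue of the tree's cube lemma `FullDescentKummerArithmetic.three_dvd_padicValRat_…`:
a uniformiser's square root is MOVED by inertia, tree `exists_mem_inertia_smul_eq_mul_of_pow_eq`); so `d = u·r²` with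
`u ∈ {1, −1, 2, −2}` (§1, class number one of `ℚ`); `u = 1` contradicts the index, `u < 0` contradicts the complex
conjugation (tree `Rank1Residual.smul_geomSqrt_eq_neg_of_isComplexConjugation`), and `Stab(√2) = Gal(ℚ̄/ℚ_1)` by the tree's
`CyclotomicZp.smul_sqrtTwo_of_mem_layerSubgroup_one` (`(ζ₈ + ζ₈⁻¹)² = 2`) and an index count.

HONEST FRAMING.  Theorems only (no definition, no named fact, no `sorry`); Galois bookkeeping over `ℚ`; nothing about
elliptic curves; BSD is not proved by any of this.  PARTITION (D-0054): none — RANK axis S3 × X5@2 stratum (β);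
types-the-object-of (stub 3b-C).

References: [cite: Washington1997, §13.1 (ℚ_1 = ℚ(√2))]; [cite: Marcus2018, Ch. 4 Ex. 32(a) (quadratic fields unramified
outside 2)]; [cite: Serre1972, §1.3 Prop. 1–2 (tame inertia moves a uniformiser's root)]; [cite: SilvermanAEC2009, Prop.
VIII.1.6 (proof)].
-/

set_option autoImplicit false
-- the route's Theorems namespace repeats the summit name by design (D-0017 nested layout)
set_option linter.dupNamespace false

noncomputable section

open scoped Classical NumberField Pointwise

namespace Summit.BirchSwinnertonDyer.BirchSwinnertonDyer.Theorems.TwoAdicWbarStep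

open Function NumberField IsDedekindDomain Field Rat.HeightOneSpectrum WithZero WeierstrassCurve
  Literature.NumberTheory.GaloisRepresentations Literature.NumberTheory.EllipticCurves
  Summit.BirchSwinnertonDyer.BirchSwinnertonDyer.Theorems.FullDescentKummerArithmetic

/-! ## §1. A rational number all of whose valuations are even is `±` a square -/

/-- A natural number whose prime exponents are all even is a square. [folklore] -/
theorem nat_exists_sq_eq_of_forall_dvd {n : ℕ} (hn : n ≠ 0) (h : ∀ p : ℕ, p.Prime → 2 ∣ padicValNat p n) :
    ∃ m : ℕ, m ^ 2 = n := by
  refine ⟨n.factorization.prod fun p e ↦ p ^ (e / 2), ?_⟩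
  conv_rhs => rw [← Nat.prod_factorization_pow_eq_self hn]
  rw [Finsupp.prod, Finsupp.prod, ← Finset.prod_pow]
  refine Finset.prod_congr rfl fun p hp ↦ ?_
  rw [← pow_mul]
  congr 1
  have hpp : p.Prime := Nat.prime_of_mem_primeFactors (Nat.support_factorization n ▸ hp)
  have h2 : 2 ∣ n.factorization p := by
    rw [Nat.factorization_def n hpp]
    exact h p hpp
  exact Nat.div_mul_cancel h2

/-- **`a ∈ ℚˣ` with `2 ∣ ord_p(a)` for every prime `p` is `± r²`** (`ℚ` has class number one). [folklore] -/
theorem exists_sq_eq_or_neg_of_forall_dvd_padicValRat {a : ℚ} (ha : a ≠ 0)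
    (h : ∀ p : ℕ, p.Prime → (2 : ℤ) ∣ padicValRat p a) : ∃ r : ℚ, r ≠ 0 ∧ (a = r ^ 2 ∨ a = -r ^ 2) := by
  have hnum : a.num ≠ 0 := Rat.num_ne_zero.mpr ha
  have hN0 : a.num.natAbs ≠ 0 := Int.natAbs_ne_zero.mpr hnum
  have hD0 : a.den ≠ 0 := a.den_nz
  have hsplit : ∀ p : ℕ, p.Prime → 2 ∣ padicValNat p a.num.natAbs ∧ 2 ∣ padicValNat p a.den := by
    intro p hp
    haveI : Fact p.Prime := ⟨hp⟩
    have hv : padicValRat p a = (padicValInt p a.num : ℤ) - (padicValNat p a.den : ℤ) := rfl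
    have hcop : Nat.Coprime a.num.natAbs a.den := a.reduced
    have h3 := h p hp
    rw [hv, padicValInt] at h3
    by_cases hpn : p ∣ a.num.natAbs
    · have hpd : ¬ p ∣ a.den := fun hpd ↦ hp.one_lt.ne' (Nat.eq_one_of_dvd_coprimes hcop hpn hpd)
      have hd0 : padicValNat p a.den = 0 := padicValNat.eq_zero_of_not_dvd hpd
      rw [hd0, Nat.cast_zero, sub_zero] at h3
      exact ⟨by exact_mod_cast h3, by rw [hd0]; exact dvd_zero 2⟩
    · have hn0 : padicValNat p a.num.natAbs = 0 := padicValNat.eq_zero_of_not_dvd hpn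
      rw [hn0, Nat.cast_zero, zero_sub, dvd_neg] at h3
      exact ⟨by rw [hn0]; exact dvd_zero 2, by exact_mod_cast h3⟩
  obtain ⟨m, hm⟩ := nat_exists_sq_eq_of_forall_dvd hN0 fun p hp ↦ (hsplit p hp).1
  obtain ⟨d, hd⟩ := nat_exists_sq_eq_of_forall_dvd hD0 fun p hp ↦ (hsplit p hp).2
  have hm0 : (m : ℚ) ≠ 0 := by
    have : m ≠ 0 := fun h0 ↦ hN0 (by rw [← hm, h0]; simp)
    exact_mod_cast this
  have hd0' : (d : ℚ) ≠ 0 := by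
    have : d ≠ 0 := fun h0 ↦ hD0 (by rw [← hd, h0]; simp)
    exact_mod_cast this
  have hdenq : (a.den : ℚ) = (d : ℚ) ^ 2 := by rw [← hd]; push_cast; ring
  refine ⟨(m : ℚ) / d, div_ne_zero hm0 hd0', ?_⟩
  rcases Int.natAbs_eq a.num with hs | hs
  · left
    have hnumq : (a.num : ℚ) = (m : ℚ) ^ 2 := by rw [hs, ← hm]; push_cast; ring
    rw [div_pow, ← hnumq, ← hdenq]
    exact (Rat.num_div_den a).symm
  · right
    have hnumq : (a.num : ℚ) = -(m : ℚ) ^ 2 := by rw [hs, ← hm]; push_cast; ring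
    rw [div_pow, neg_div', ← hnumq, ← hdenq]
    exact (Rat.num_div_den a).symm

/-! ## §2. At an odd prime: an inertia group fixing `√a` forces `2 ∣ ord_p(a)` -/

/-- The place of `ℚ` at a prime `p` (`natGenerator (primesEquiv⁻¹ p) = p`). [folklore] -/
theorem natGenerator_primesEquiv_symm {p : ℕ} (hp : p.Prime) :
    natGenerator ((primesEquiv (R := 𝓞 ℚ)).symm ⟨p, hp⟩) = p := by
  have h := (primesEquiv (R := 𝓞 ℚ)).apply_symm_apply ⟨p, hp⟩
  exact congrArg Subtype.val h

/-- **Unramified square roots away from `2`, integral form.** `p` odd, `v` the place of `ℚ` at `p`, `𝔓 ∣ v` a prime of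
`\bar ℤ`, `c ∈ ℤ ∖ {0}`, `β² = c`: if every element of `I_𝔓 ≤ Γ_ℚ` fixes `β` then `2 ∣ ord_p(c)` (else `γ := β/(p^q π)`,
`π² = p`, `ord_p c = 2q+1`, has `γ² = c'` a `p`-unit, so `I_𝔓` fixes `γ` and hence `π` — but some `s ∈ I_𝔓` has `sπ = −π`).
[cite: SilvermanAEC2009, Prop. VIII.1.6 (proof)] [cite: Serre1972, §1.3 Prop. 1–2] -/
theorem two_dvd_padicValInt_of_forall_inertia_smul_eq {p : ℕ} (hp : p.Prime) (hp2 : p ≠ 2)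
    {v : HeightOneSpectrum (𝓞 ℚ)} (hv : natGenerator v = p)
    {𝔓 : Ideal (absIntegers (𝓞 ℚ) ℚ)} (h𝔓 : 𝔓 ∈ v.primesAbove)
    {c : ℤ} (hc : c ≠ 0) {β : AlgebraicClosure ℚ} (hβ : β ^ 2 = (c : AlgebraicClosure ℚ))
    (hI : ∀ τ ∈ 𝔓.inertia (absoluteGaloisGroup ℚ), τ • β = β) :
    2 ∣ padicValInt p c := by
  haveI : Fact p.Prime := ⟨hp⟩
  by_contra h3
  set k : ℕ := padicValInt p c with hk
  obtain ⟨c', hcc'⟩ := padicValInt_dvd (p := p) c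
  rw [← hk] at hcc'
  have hc'0 : c' ≠ 0 := fun h ↦ hc (by rw [hcc', h, mul_zero])
  have hpc' : ¬ (p : ℤ) ∣ c' := by
    rintro ⟨c'', rfl⟩
    have h1 : (p : ℤ) ^ (k + 1) ∣ c := ⟨c'', by rw [hcc']; ring⟩
    rcases (padicValInt_dvd_iff (k + 1) c).mp h1 with h | h
    · exact hc h
    · rw [← hk] at h; omega
  set q : ℕ := k / 2 with hq
  have hkq : k = 2 * q + 1 := by omega
  -- a square root `π` of `p`
  obtain ⟨π, hπ⟩ := IsAlgClosed.exists_pow_nat_eq ((p : ℕ) : AlgebraicClosure ℚ) (by norm_num : 0 < 2)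
  have hp0 : ((p : ℕ) : AlgebraicClosure ℚ) ≠ 0 := Nat.cast_ne_zero.mpr hp.ne_zero
  have hπ0 : π ≠ 0 := by
    intro h
    rw [h, zero_pow (by norm_num)] at hπ
    exact hp0 hπ.symm
  -- `γ := β / (p^q π)`, `γ² = c'`
  set γ : AlgebraicClosure ℚ := β * (((p : ℕ) : AlgebraicClosure ℚ) ^ q * π)⁻¹ with hγ
  have hden0 : ((p : ℕ) : AlgebraicClosure ℚ) ^ q * π ≠ 0 := mul_ne_zero (pow_ne_zero _ hp0) hπ0
  have hγ2 : γ ^ 2 = (c' : AlgebraicClosure ℚ) := by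
    have h1 : (((p : ℕ) : AlgebraicClosure ℚ) ^ q * π) ^ 2 = ((p : ℕ) : AlgebraicClosure ℚ) ^ k := by
      rw [mul_pow, ← pow_mul, hπ, ← pow_succ, mul_comm q 2, hkq]
    have h2 : (c : AlgebraicClosure ℚ) = ((p : ℕ) : AlgebraicClosure ℚ) ^ k * (c' : AlgebraicClosure ℚ) := by
      rw [hcc']; push_cast; ring
    rw [hγ, mul_pow, inv_pow, h1, hβ, h2, mul_comm (((p : ℕ) : AlgebraicClosure ℚ) ^ k),
      mul_assoc, mul_inv_cancel₀ (pow_ne_zero _ hp0), mul_one]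
  -- `I_𝔓` fixes `γ`
  have hc'O : ((c' : 𝓞 ℚ) : 𝓞 ℚ) ∉ v.asIdeal := by
    rw [Rat.intCast_mem_asIdeal_iff, hv]
    exact hpc'
  have h2O : ((2 : ℕ) : 𝓞 ℚ) ∉ v.asIdeal := by
    rw [Rat.natCast_mem_asIdeal_iff, hv, Nat.prime_dvd_prime_iff_eq hp Nat.prime_two]
    exact hp2
  have hγ2' : γ ^ 2 = algebraMap (𝓞 ℚ) (AlgebraicClosure ℚ) (c' : 𝓞 ℚ) := by
    rw [map_intCast]; exact hγ2
  have hIγ : ∀ τ ∈ 𝔓.inertia (absoluteGaloisGroup ℚ), τ • γ = γ := fun τ hτ ↦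
    absoluteGaloisGroup_inertia_fixes_root_of_not_mem v hc'O h2O hγ2' h𝔓 hτ
  -- hence fixes `π`
  have hpfix : ∀ τ : absoluteGaloisGroup ℚ, τ • ((p : ℕ) : AlgebraicClosure ℚ) = p := fun τ ↦ by
    rw [absoluteGaloisGroup.smul_def, map_natCast]
  have hβ0 : β ≠ 0 := by
    intro h
    rw [h, zero_pow (by norm_num), eq_comm, Int.cast_eq_zero] at hβ
    exact hc hβ
  have hfix : ∀ τ ∈ 𝔓.inertia (absoluteGaloisGroup ℚ), τ • π = π := by
    intro τ hτ
    have h1 := hIγ τ hτ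
    rw [hγ, smul_mul', hI τ hτ, smul_inv'', smul_mul', smul_pow', hpfix] at h1
    have h2 := mul_left_cancel₀ hβ0 h1
    have h3' := inv_injective h2
    exact mul_left_cancel₀ (pow_ne_zero _ hp0) h3'
  -- but some `s ∈ I_𝔓` moves `π` to `−π`
  have hv' : (primesEquiv v : ℕ) = p := hv
  have hζ : ((-1 : AlgebraicClosure ℚ)) ^ 2 = 1 := by norm_num
  obtain ⟨s, hsI, hs⟩ :=
    exists_mem_inertia_smul_eq_mul_of_pow_eq p (by norm_num : 0 < 2) hv' h𝔓 hπ hζ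
  have h4 := hfix s hsI
  rw [hs, neg_one_mul] at h4
  have h5 : (2 : AlgebraicClosure ℚ) * π = 0 := by
    rw [two_mul]
    nth_rewrite 1 [← h4]
    exact neg_add_cancel π
  exact hπ0 ((mul_eq_zero.mp h5).resolve_left two_ne_zero)

/-- **Unramified square roots away from `2`, rational form**: `p` odd, `𝔓 ∣ p` a prime of `\bar ℤ`, `a ∈ ℚˣ`; if `I_𝔓` fixes
`√a` (`WeierstrassCurve.geomSqrt a`) then `2 ∣ ord_p(a)` (integral form for `β = √a · den(a)`, `β² = num(a) den(a)`).
[cite: SilvermanAEC2009, Prop. VIII.1.6 (proof)] [cite: Serre1972, §1.3 Prop. 1–2] -/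
theorem two_dvd_padicValRat_of_forall_inertia_smul_eq {p : ℕ} (hp : p.Prime) (hp2 : p ≠ 2)
    {v : HeightOneSpectrum (𝓞 ℚ)} (hv : natGenerator v = p)
    {𝔓 : Ideal (absIntegers (𝓞 ℚ) ℚ)} (h𝔓 : 𝔓 ∈ v.primesAbove)
    {a : ℚ} (ha : a ≠ 0) (hI : ∀ τ ∈ 𝔓.inertia (absoluteGaloisGroup ℚ), τ • geomSqrt a = geomSqrt a) :
    (2 : ℤ) ∣ padicValRat p a := by
  haveI : Fact p.Prime := ⟨hp⟩
  have hnum : a.num ≠ 0 := Rat.num_ne_zero.mpr ha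
  have hden : (a.den : ℤ) ≠ 0 := Int.natCast_ne_zero.mpr a.den_nz
  set c : ℤ := a.num * (a.den : ℤ) with hc
  have hc0 : c ≠ 0 := mul_ne_zero hnum hden
  set β : AlgebraicClosure ℚ := geomSqrt a * ((a.den : ℕ) : AlgebraicClosure ℚ) with hβ
  have hβ2 : β ^ 2 = (c : AlgebraicClosure ℚ) := by
    have hden' : ((a.den : ℕ) : AlgebraicClosure ℚ) ≠ 0 := Nat.cast_ne_zero.mpr a.den_nz
    have hsq : geomSqrt a ^ 2 = ((a : ℚ) : AlgebraicClosure ℚ) := by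
      rw [geomSqrt_sq]; rfl
    rw [hβ, mul_pow, hsq, hc, Rat.cast_def]
    push_cast
    field_simp
  have hIβ : ∀ τ ∈ 𝔓.inertia (absoluteGaloisGroup ℚ), τ • β = β := fun τ hτ ↦ by
    rw [hβ, smul_mul', hI τ hτ, absoluteGaloisGroup.smul_def τ ((a.den : ℕ) : AlgebraicClosure ℚ), map_natCast]
  have h3 := two_dvd_padicValInt_of_forall_inertia_smul_eq hp hp2 hv h𝔓 hc0 hβ2 hIβ
  have hv1 : padicValInt p c = padicValInt p a.num + padicValNat p a.den := by
    rw [hc, padicValInt.mul hnum hden, padicValInt.of_nat]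
  have hv2 : padicValRat p a = (padicValInt p a.num : ℤ) - (padicValNat p a.den : ℤ) := rfl
  rw [hv2]
  rw [hv1] at h3
  have h3' : (2 : ℤ) ∣ ((padicValInt p a.num : ℤ) + (padicValNat p a.den : ℤ)) := by exact_mod_cast h3
  have : (padicValInt p a.num : ℤ) - (padicValNat p a.den : ℤ) =
      ((padicValInt p a.num : ℤ) + (padicValNat p a.den : ℤ)) - 2 * (padicValNat p a.den : ℤ) := by ring
  rw [this]
  exact dvd_sub h3' (dvd_mul_right 2 _)

/-! ## §3. Stabilisers of square roots: `Stab(√(u r²)) = Stab(√u)`, `Stab(√(r²)) = Γ` -/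

section Stabilizers

variable {F : Type*} [Field F]

/-- `σ ∈ Γ_F` fixes `√(u r²)` iff it fixes `√u` (`r ≠ 0`; `√(u r²) = ± r √u`). [folklore] -/
theorem smul_geomSqrt_mul_sq_iff (σ : absoluteGaloisGroup F) (u : F) {r : F} (hr : r ≠ 0) :
    σ • geomSqrt (u * r ^ 2) = geomSqrt (u * r ^ 2) ↔ σ • geomSqrt u = geomSqrt u := by
  set c : AlgebraicClosure F := algebraMap F (AlgebraicClosure F) r with hc
  have hc0 : c ≠ 0 := by rw [hc]; exact (map_ne_zero _).mpr hr
  have hσc : ∀ x : AlgebraicClosure F, σ • (c * x) = c * σ • x := fun x ↦ by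
    rw [smul_mul', absoluteGaloisGroup.smul_def σ c, hc, AlgEquiv.commutes]
  have hsq : geomSqrt (u * r ^ 2) ^ 2 = (c * geomSqrt u) ^ 2 := by
    rw [geomSqrt_sq, mul_pow, geomSqrt_sq, hc, map_mul, map_pow]; ring
  rcases sq_eq_sq_iff_eq_or_eq_neg.mp hsq with h | h
  · rw [h, hσc]
    exact ⟨fun e ↦ mul_left_cancel₀ hc0 e, fun e ↦ by rw [e]⟩
  · rw [h, smul_neg, hσc, neg_inj]
    exact ⟨fun e ↦ mul_left_cancel₀ hc0 e, fun e ↦ by rw [e]⟩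

/-- `Stab(√(u r²)) = Stab(√u)` in `Γ_F` for `r ≠ 0`. [folklore] -/
theorem stabilizer_geomSqrt_mul_sq (u : F) {r : F} (hr : r ≠ 0) :
    MulAction.stabilizer (absoluteGaloisGroup F) (geomSqrt (u * r ^ 2)) =
      MulAction.stabilizer (absoluteGaloisGroup F) (geomSqrt u) := by
  ext σ
  simp only [MulAction.mem_stabilizer_iff]
  exact smul_geomSqrt_mul_sq_iff σ u hr

/-- Every `σ ∈ Γ_F` fixes `√(r²) = ± r`. [folklore] -/
theorem smul_geomSqrt_sq (σ : absoluteGaloisGroup F) (r : F) : σ • geomSqrt (r ^ 2) = geomSqrt (r ^ 2) := by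
  have hsq : geomSqrt (r ^ 2) ^ 2 = (algebraMap F (AlgebraicClosure F) r) ^ 2 := by
    rw [geomSqrt_sq, map_pow]
  rcases sq_eq_sq_iff_eq_or_eq_neg.mp hsq with h | h
  · rw [h, absoluteGaloisGroup.smul_def, AlgEquiv.commutes]
  · rw [h, smul_neg, absoluteGaloisGroup.smul_def, AlgEquiv.commutes]

/-- `Stab(√(r²)) = Γ_F`. [folklore] -/
theorem stabilizer_geomSqrt_sq_eq_top (r : F) :
    MulAction.stabilizer (absoluteGaloisGroup F) (geomSqrt (r ^ 2)) = ⊤ := by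
  rw [eq_top_iff]
  intro σ _
  exact smul_geomSqrt_sq σ r

end Stabilizers

/-! ## §4. `Gal(ℚ̄/ℚ_1) ≤ Stab(√2)` and the main statement -/

/-- **`Gal(ℚ̄/ℚ_1)` fixes `√2`** for the normalised cyclotomic `ℤ₂`-extension `κ_cyc` of `ℚ` (`ℚ_1 = ℚ(√2)`): `√2 = ±(ζ₈ + ζ₈⁻¹)`
and the tree's `CyclotomicZp.smul_sqrtTwo_of_mem_layerSubgroup_one`. [cite: Washington1997, §13.1] -/
theorem layerSubgroup_one_le_stabilizer_geomSqrt_two :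
    (CyclotomicZp.zpExtension 2).layerSubgroup 1 ≤
      MulAction.stabilizer (absoluteGaloisGroup ℚ) (geomSqrt (2 : ℚ)) := by
  haveI : NeZero (2 ^ 3 : ℕ) := ⟨by norm_num⟩
  obtain ⟨ζ, hζ⟩ := HasEnoughRootsOfUnity.exists_primitiveRoot (AlgebraicClosure ℚ) (2 ^ 3)
  intro σ hσ
  rw [MulAction.mem_stabilizer_iff]
  have hfix := CyclotomicZp.smul_sqrtTwo_of_mem_layerSubgroup_one hσ hζ
  have hsq : geomSqrt (2 : ℚ) ^ 2 = (ζ + ζ ^ 7) ^ 2 := by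
    rw [geomSqrt_sq, CyclotomicZp.sq_add_pow_seven_eq_two hζ, map_ofNat]
  rcases sq_eq_sq_iff_eq_or_eq_neg.mp hsq with h | h
  · rw [h, hfix]
  · rw [h, smul_neg, hfix]

/-- **The quadratic extension of `ℚ` unramified at all odd primes and at `∞` is `ℚ_1 = ℚ(√2)`** (Galois form).  An OPEN subgroup
`U ≤ Γ_ℚ` of index `2` which contains the inertia group of every prime of `\bar ℤ` above every odd prime, and every complex
conjugation, equals `Gal(ℚ̄/ℚ_1)`, the first layer of the (normalised) cyclotomic `ℤ₂`-extension.  (Kummer: `U = Stab(√d)`;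
the inertia hypothesis makes `ord_p d` even for odd `p`, so `d ∈ {1, −1, 2, −2}·ℚˣ²`; complex conjugation excludes `d < 0`,
the index excludes `d ∈ ℚˣ²`.) [cite: Marcus2018, Ch. 4 Ex. 32(a)] [cite: Washington1997, §13.1] -/
theorem eq_layerSubgroup_one_of_index_two (U : Subgroup (absoluteGaloisGroup ℚ))
    (hUo : IsOpen (U : Set (absoluteGaloisGroup ℚ))) (hU2 : U.index = 2)
    (hI : ∀ v : HeightOneSpectrum (𝓞 ℚ), ((2 : ℕ) : 𝓞 ℚ) ∉ v.asIdeal →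
      ∀ 𝔓 ∈ v.primesAbove, 𝔓.inertia (absoluteGaloisGroup ℚ) ≤ U)
    (hcc : ∀ c₀ : absoluteGaloisGroup ℚ, IsComplexConjugation (Rat.castHom ℝ) c₀ → c₀ ∈ U) :
    U = (CyclotomicZp.zpExtension 2).layerSubgroup 1 := by
  obtain ⟨d, hd0, hUd⟩ := MasserWustholz1993.exists_eq_stabilizer_geomSqrt_of_index_eq_two ℚ U hUo hU2
  -- (a) every odd prime has an even exponent in `d`
  have hodd : ∀ p : ℕ, p.Prime → p ≠ 2 → (2 : ℤ) ∣ padicValRat p d := by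
    intro p hp hp2
    set v : HeightOneSpectrum (𝓞 ℚ) := (primesEquiv (R := 𝓞 ℚ)).symm ⟨p, hp⟩ with hvdef
    have hv : natGenerator v = p := natGenerator_primesEquiv_symm hp
    have h2v : ((2 : ℕ) : 𝓞 ℚ) ∉ v.asIdeal := by
      rw [Rat.natCast_mem_asIdeal_iff, hv, Nat.prime_dvd_prime_iff_eq hp Nat.prime_two]
      exact hp2
    obtain ⟨𝔓, h𝔓⟩ := v.primesAbove_nonempty
    refine two_dvd_padicValRat_of_forall_inertia_smul_eq hp hp2 hv h𝔓 hd0 fun τ hτ ↦ ?_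
    have hmem : τ ∈ U := hI v h2v 𝔓 h𝔓 hτ
    rw [hUd] at hmem
    exact hmem
  -- (b) `d = u r²` with `u ∈ {1, -1, 2, -2}`
  have key : ∃ (r u : ℚ), r ≠ 0 ∧ d = u * r ^ 2 ∧ (u = 1 ∨ u = -1 ∨ u = 2 ∨ u = -2) := by
    by_cases h2 : (2 : ℤ) ∣ padicValRat 2 d
    · obtain ⟨r, hr0, hr⟩ := exists_sq_eq_or_neg_of_forall_dvd_padicValRat hd0 fun p hp ↦ by
        by_cases hp2 : p = 2
        · subst hp2; exact h2
        · exact hodd p hp hp2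
      rcases hr with h | h
      · exact ⟨r, 1, hr0, by rw [h, one_mul], Or.inl rfl⟩
      · exact ⟨r, -1, hr0, by rw [h]; ring, Or.inr (Or.inl rfl)⟩
    · have hb0 : d / 2 ≠ 0 := div_ne_zero hd0 two_ne_zero
      obtain ⟨r, hr0, hr⟩ := exists_sq_eq_or_neg_of_forall_dvd_padicValRat hb0 fun p hp ↦ by
        haveI : Fact p.Prime := ⟨hp⟩
        rw [padicValRat.div hd0 two_ne_zero]
        by_cases hp2 : p = 2
        · subst hp2
          have hself : padicValRat 2 (2 : ℚ) = 1 := by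
            rw [show (2 : ℚ) = ((2 : ℕ) : ℚ) by norm_num]
            exact padicValRat.self (by norm_num)
          rw [hself]
          have h2' := Int.emod_two_ne_zero.mp (fun h ↦ h2 (Int.dvd_of_emod_eq_zero h))
          rw [Int.dvd_iff_emod_eq_zero, Int.sub_emod, h2']
          decide
        · have h20 : padicValRat p (2 : ℚ) = 0 := by
            haveI : Fact (Nat.Prime 2) := ⟨Nat.prime_two⟩
            rw [show (2 : ℚ) = ((2 : ℕ) : ℚ) by norm_num, padicValRat.of_nat, padicValNat_primes hp2]
            simp
          rw [h20, sub_zero]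
          exact hodd p hp hp2
      rcases hr with h | h
      · exact ⟨r, 2, hr0, by rw [mul_comm, ← h]; ring, Or.inr (Or.inr (Or.inl rfl))⟩
      · refine ⟨r, -2, hr0, ?_, Or.inr (Or.inr (Or.inr rfl))⟩
        have : d = 2 * (d / 2) := by ring
        rw [this, h]; ring
  obtain ⟨r, u, hr0, hdu, hu⟩ := key
  have hUu : U = MulAction.stabilizer (absoluteGaloisGroup ℚ) (geomSqrt u) := by
    rw [hUd, hdu, stabilizer_geomSqrt_mul_sq u hr0]
  -- the four cases
  have hneg : ∀ u' : ℚ, u' < 0 → U ≠ MulAction.stabilizer (absoluteGaloisGroup ℚ) (geomSqrt u') := by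
    intro u' hu' hU'
    obtain ⟨c₀, hc₀⟩ := exists_isComplexConjugation (Rat.castHom ℝ)
    have hmem := hcc c₀ hc₀
    rw [hU', MulAction.mem_stabilizer_iff, Rank1Residual.smul_geomSqrt_eq_neg_of_isComplexConjugation hu' hc₀] at hmem
    exact geomSqrt_ne_neg hu'.ne hmem.symm
  rcases hu with rfl | rfl | rfl | rfl
  · exfalso
    have htop : U = ⊤ := by rw [hUu, show (1 : ℚ) = 1 ^ 2 by norm_num]; exact stabilizer_geomSqrt_sq_eq_top 1
    rw [htop, Subgroup.index_top] at hU2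
    exact absurd hU2 (by norm_num)
  · exact absurd hUu (hneg (-1) (by norm_num))
  · have hle : (CyclotomicZp.zpExtension 2).layerSubgroup 1 ≤ U :=
      hUu ▸ layerSubgroup_one_le_stabilizer_geomSqrt_two
    have hidx : ((CyclotomicZp.zpExtension 2).layerSubgroup 1).index = 2 := by
      rw [ZpExtension.index_layerSubgroup, pow_one]
    refine le_antisymm ?_ hle
    have hrel := Subgroup.relIndex_mul_index hle
    rw [hU2, hidx] at hrel
    have h1 : ((CyclotomicZp.zpExtension 2).layerSubgroup 1).relIndex U = 1 := by omega
    exact Subgroup.relIndex_eq_one.mp h1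
  · exact absurd hUu (hneg (-2) (by norm_num))

end Summit.BirchSwinnertonDyer.BirchSwinnertonDyer.Theorems.TwoAdicWbarStep

end
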